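import Summits.ValiantsHypothesis.ValiantsHypothesis.Theorems.KPlusLogSqLawTropicalBTwoBoundaryPortBounds
import Summits.ValiantsHypothesis.ValiantsHypothesis.Theorems.KPlusLogSqLawTropicalCensusRows

/-!
# Route «KPlusLogSqLaw», crux `TropicalB` (stmt-ValiantsHypothesis-19771) — the TWO-BOUNDARY PORT of SHIFT-THREE, part 3:
# every grid term is a unique optimum of the port; `¬ BoundaryVertexLaw 2 1` (two boundaries are at least QUADRATIC)

HONEST FRAMING.  Proof file (pure theorems), seat val-sym-trop-p1 g17 (cell `pub-symmetroid`, 2026-08-28), `--supports stmt-ValiantsHypothesis-19771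
--as helper`, toward the registered stubs `stub_tropThin` / `stub_tropFat` of `Cruxes/TropicalB/Lines/birth.lean` (crux `TropicalB`).  It DECIDES a
located question of the lineage's boundary-sector programme (HOME/val-sym-trop-p1/g15/THRESHOLD-NORMAL-FORM-g15.md §3/§6, g16/ONE-CUT-g16.md §3(b′):
«is there ANY two-boundary design with super-linear dominant count? located guess: BVL(2,1) linear»): the answer is YES, quadratically many —

* `isDominant_bigTerm` — for every grid point `(p, a)` of SHIFT-THREE (`p ≤ n`, `a + p ≤ n + 1`) the ported term `bigTerm (cterm p a)` is the
  UNIQUE optimum of the dense two-boundary design `(dd, bigV, bigE)` at the integer slope `th p a`.  Proof: the scale-`2` dual certificate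
  (`potU`, `potW`) fed to `TropicalCensus.isDominant_of_scaledPotential` (val-sym-trop-p2's census tool): tight on the term's cells (`tight`), strict
  on every other present cell (`slack`) — on real cells and priced partner cells by SHIFT-THREE's per-entry domination `ShiftThree.phi_lt` read
  through `phi_eq`, on the toggle / home cells by the half-unit offsets of the partner-row potentials, on the junk cells by the polynomial bounds
  `G_bounds` (`|phi| ≤ 8(n+3)⁴`) against `huge = 32(n+3)⁴`;
* `bigTerm_cterm_inj`, `T_le_card_dominant` — the port separates the grid, so the design has at least `T n (n+1) = C(n+3,2) − 1` dominant terms;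
  `exists_twoBoundary_quadratic` — the ∃-form: a dense boundary-type design with TWO boundaries on `2m` nodes and `≥ C(m+2,2) − 1` dominant terms;
* **`not_boundaryVertexLaw_two_one : ¬ BoundaryVertexLaw 2 1`** — no constant `C` bounds the dominant count of two-boundary designs by `C·(M+1)`
  (take `n = 4C + 1`).  So the exponent `e` of the two-boundary sector satisfies `2 ≤ e` (this file) and `e ≤ 3` (counting,
  `boundaryVertexLaw_sharpCounting`); the cell's target `BoundaryVertexLaw 2 2` (g2) is therefore SHARP if true.
READING (located, not a theorem): the mechanism is a PORT — SHIFT-THREE's menu entries (two classes on one cell) become pairs of single-class cells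
whose classes are order bits; one extra boundary buys exactly the toggle digit.  Nothing here bounds `TropicalB` in its window; nothing bears on
`WeakLifting`, DoorA26 / DoorA34, `MatrixDescartes` (stmt-ValiantsHypothesis-18050) or VP ≠ VNP.
-/

set_option linter.dupNamespace false
set_option autoImplicit false

namespace Summit.ValiantsHypothesis.ValiantsHypothesis.Theorems.KPlusLogSqLaw

namespace BoundarySector

namespace TwoPort

open Summit.ValiantsHypothesis.ValiantsHypothesis.Theorems.MatrixDescartes.Negative
open Summit.ValiantsHypothesis.ValiantsHypothesis.Theorems.LacunarySymmetroidMatrixDescartes.TropicalCensus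
open Summit.ValiantsHypothesis.ValiantsHypothesis.Theorems.LacunarySymmetroidMatrixDescartes.TropicalCensus.ShiftThree
open Finset

variable (n : ℕ)

variable {n} {p a : ℕ}

/-! ### 7. The certificate: tightness on the term, strictness elsewhere -/

/-- tightness of the scale-`2` certificate on the cells of the big term. -/
theorem tight (hp : p ≤ n) (ha : a + p ≤ n + 1) (y : Fin ((n + 1) + (n + 1))) :
    potU n p a (bigPerm n (rot n p) (lam n p a) y) + potW n p a y =
      2 * (th n p a * (dd n (bigCls n (rot n p) (lam n p a) y) : ℤ) -
        bigV n (bigPerm n (rot n p) (lam n p a) y) y (bigCls n (rot n p) (lam n p a) y)) := by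
  rcases re_or_pa n y with ⟨b, rfl⟩ | ⟨b, rfl⟩
  · by_cases h : lam n p a b = 1
    · rw [bigCls_re_of_eq n _ _ b h, bigPerm_re_of_eq n _ _ b h, potU_PA, potW_RE, bigV_pr, if_pos rfl, if_pos h, dd_one]
      push_cast; ring
    · have hl := lam_eq_wrapClass hp ha b h
      rw [bigCls_re_of_ne n _ _ b h, bigPerm_re_of_ne n _ _ b h, potU_RE, potW_RE, bigV_rr, if_neg h, ← hl]
      have e := phi_eq n (th n p a) (rot n p b) b (lam n p a b)
      unfold G; rw [e]; ring
  · by_cases h : lam n p a b = 1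
    · rw [bigCls_pa_of_eq n _ _ b h, bigPerm_pa_of_eq n _ _ b h, potU_RE, potW_PA, bigV_rp, if_pos h, dd_zero]
      have e := phi_eq n (th n p a) (rot n p b) b (lam n p a b)
      rw [h, dd_one] at e
      unfold G; rw [h, e]; push_cast; ring
    · rw [bigCls_pa_of_ne n _ _ b h, bigPerm_pa_of_ne n _ _ b h, potU_PA, potW_PA, bigV_pp, if_pos rfl, if_neg h, dd_zero]
      push_cast; ring

/-- the key SHIFT-THREE comparison for a cell of column `b` other than the grid entry: `2·phi ≤ 2·G − 2`. -/
theorem two_phi_le (hp : p ≤ n) (ha : a + p ≤ n + 1) (a' b : Fin (n + 1)) (l : Fin 3) (h : ee n a' b l ≠ 0)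
    (hne : a' ≠ rot n p b ∨ l ≠ lam n p a b) :
    2 * phi n (th n p a) a' b l ≤ 2 * G n p a b - 2 := by
  have := phi_lt n p a hp ha a' b l h hne
  unfold G; linarith

/-- strictness of the scale-`2` certificate off the cells of the big term. -/
theorem slack (hp : p ≤ n) (ha : a + p ≤ n + 1) (x y : Fin ((n + 1) + (n + 1))) (l : Fin 3)
    (hE : bigE n x y l ≠ 0) (hne : bigPerm n (rot n p) (lam n p a) y ≠ x ∨ bigCls n (rot n p) (lam n p a) y ≠ l) :
    2 * (th n p a * (dd n l : ℤ) - bigV n x y l) < potU n p a x + potW n p a y := by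
  have hl : l = lab3 (pattern (bd n) (bd n) x y) := by
    by_contra hl; exact hE (by unfold bigE; rw [if_neg hl])
  have hθ1 : 1 ≤ th n p a := th_pos n p a
  -- bounds for the junk cells
  set N := (n : ℤ) + 3 with hNdef
  have hN : (3 : ℤ) ≤ N := by rw [hNdef]; linarith [Int.natCast_nonneg n]
  have hN2 : (9 : ℤ) ≤ N ^ 2 := by nlinarith
  have hN4 : 9 * N ^ 2 ≤ N ^ 4 := by nlinarith
  have hθ2 : th n p a ≤ 2 * N ^ 2 := th_le hp ha
  have hG : ∀ b : Fin (n + 1), -(7 * N ^ 4) ≤ G n p a b ∧ G n p a b ≤ 8 * N ^ 4 := fun b => G_bounds hp ha b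
  have hcb : ∀ b : Fin (n + 1), 0 ≤ th n p a * (2 * n + 5) * (b : ℤ) ∧
      th n p a * (2 * n + 5) * (b : ℤ) ≤ (2 * N ^ 2) * (2 * N) * N := by
    intro b
    have hb : ((b : ℕ) : ℤ) ≤ N := by
      have := b.isLt; rw [hNdef]; exact_mod_cast (by omega : (b : ℕ) ≤ n + 3)
    have hc : (2 * (n : ℤ) + 5) ≤ 2 * N := by rw [hNdef]; linarith
    exact ⟨by positivity, mul_le_mul (mul_le_mul hθ2 hc (by positivity) (by positivity)) hb (by positivity) (by positivity)⟩
  have hhuge : huge n = 32 * N ^ 4 := by unfold huge; rw [hNdef]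
  rcases re_or_pa n x with ⟨a', rfl⟩ | ⟨b', rfl⟩ <;> rcases re_or_pa n y with ⟨b, rfl⟩ | ⟨b, rfl⟩
  · -- real row, real column
    rw [lab_rr] at hl
    rw [bigV_rr, potU_RE, potW_RE]
    have hne' : a' ≠ rot n p b ∨ l ≠ lam n p a b := by
      by_cases ht : lam n p a b = 1
      · right; rw [ht, hl]; split_ifs <;> decide
      · left
        intro hab
        rw [bigPerm_re_of_ne n _ _ b ht, bigCls_re_of_ne n _ _ b ht, ← hab, ← hl] at hne
        simp at hne
    have key := two_phi_le hp ha a' b l (hl ▸ ee_wrapClass_ne_zero n a' b) hne'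
    rw [phi_eq] at key
    have hδ : (0 : ℤ) ≤ (if lam n p a b = 1 then 1 else 0) ∧ (if lam n p a b = 1 then (1 : ℤ) else 0) ≤ 1 := by
      split_ifs <;> norm_num
    linarith [hδ.1, hδ.2]
  · -- real row `a'`, partner column `b`
    rw [lab_rp] at hl
    subst hl
    rw [bigV_rp, potU_RE, potW_PA, dd_zero]
    have key : 2 * phi n (th n p a) a' b 1 ≤ 2 * G n p a b - 2 := by
      by_cases hw : (a' : ℕ) < (b : ℕ)
      · have h1 := phi_one_lt_phi_two n hθ1 a' b
        have h2 := phi_le n p a hp ha a' b 2 (by have := ee_wrapClass_ne_zero n a' b; rwa [if_pos hw] at this)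
        unfold G; linarith
      · refine two_phi_le hp ha a' b 1 (ee_one_ne_zero n hw) ?_
        by_cases ht : lam n p a b = 1
        · left
          intro hab
          rw [bigPerm_pa_of_eq n _ _ b ht, bigCls_pa_of_eq n _ _ b ht, ← hab] at hne
          simp at hne
        · exact Or.inr (fun h => ht h.symm)
    rw [phi_eq, dd_one] at key
    have hδ : (0 : ℤ) ≤ (if lam n p a b = 1 then 0 else 1) ∧ (if lam n p a b = 1 then (0 : ℤ) else 1) ≤ 1 := by
      split_ifs <;> norm_num
    push_cast at key ⊢
    linarith [hδ.1, hδ.2]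
  · -- partner row `b'`, real column `b`
    rw [lab_pr] at hl
    subst hl
    rw [bigV_pr, potU_PA, potW_RE, dd_one]
    by_cases hb : b' = b
    · subst hb
      rw [if_pos rfl]
      have ht : lam n p a b' ≠ 1 := by
        intro ht
        rw [bigPerm_re_of_eq n _ _ b' ht, bigCls_re_of_eq n _ _ b' ht] at hne
        simp at hne
      rw [if_neg ht]; push_cast; linarith
    · rw [if_neg hb, hhuge]
      have hδ : (if lam n p a b = 1 then (1 : ℤ) else 0) ≤ 1 := by split_ifs <;> norm_num
      push_cast
      nlinarith [(hG b').2, (hG b).1, (hcb b').2, (hcb b).1]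
  · -- partner row `b'`, partner column `b`
    rw [lab_pp] at hl
    rw [bigV_pp, potU_PA, potW_PA]
    by_cases hb : b' = b
    · subst hb
      rw [if_neg (lt_irrefl _)] at hl
      subst hl
      rw [if_pos rfl, dd_zero]
      have ht : lam n p a b' = 1 := by
        by_contra ht
        rw [bigPerm_pa_of_ne n _ _ b' ht, bigCls_pa_of_ne n _ _ b' ht] at hne
        simp at hne
      rw [if_pos ht]; push_cast; linarith
    · rw [if_neg hb, hhuge]
      have hdl : th n p a * (dd n l : ℤ) ≤ (2 * N ^ 2) * (2 * N ^ 2) :=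
        mul_le_mul hθ2 ((dd_le l).trans bigD_le) (by positivity) (by positivity)
      have hδ : (if lam n p a b = 1 then (0 : ℤ) else 1) ≤ 1 := by split_ifs <;> norm_num
      nlinarith [(hG b').2, (hG b).1, (hcb b').2, (hcb b).1]

/-- **Every grid term of SHIFT-THREE is a unique optimum of the two-boundary port** (at the same integer slope). -/
theorem isDominant_bigTerm (hp : p ≤ n) (ha : a + p ≤ n + 1) :
    IsDominant (dd n) (bigV n) (bigE n) (th n p a) (bigTerm n (cterm n p a)) := by
  unfold bigTerm cterm
  exact isDominant_of_scaledPotential (dd n) (bigV n) (bigE n) (th n p a) (bigPerm n (rot n p) (lam n p a))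
    (bigCls n (rot n p) (lam n p a)) 2 (by norm_num) (potU n p a) (potW n p a)
    (fun y => by unfold bigE bigCls; rw [if_pos rfl]; exact one_ne_zero)
    (fun y => tight hp ha y) (fun x y l hE hne => slack hp ha x y l hE hne)

/-! ### 8. Counting the dominant terms; `¬ BoundaryVertexLaw 2 1` -/

/-- the term map separates the grid. -/
theorem bigTerm_cterm_inj {p a p' a' : ℕ} (hp : p ≤ n) (ha : a + p ≤ n + 1) (hp' : p' ≤ n) (ha' : a' + p' ≤ n + 1)
    (h : bigTerm n (cterm n p a) = bigTerm n (cterm n p' a')) : p = p' ∧ a = a' := by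
  have hperm : ∀ y, bigPerm n (rot n p) (lam n p a) y = bigPerm n (rot n p') (lam n p' a') y := fun y => by
    have := congrArg Prod.fst h
    unfold bigTerm cterm at this
    exact congrFun (congrArg (fun e : Equiv.Perm _ => (e : _ → _)) this) y
  -- same toggles
  have htog : ∀ b : Fin (n + 1), lam n p a b = 1 ↔ lam n p' a' b = 1 := by
    intro b
    have hb := hperm ((Fin.castAdd (n + 1)) b)
    constructor
    · intro h1
      by_contra h2
      rw [bigPerm_re_of_eq n _ _ b h1, bigPerm_re_of_ne n _ _ b h2] at hb
      exact RE_ne_PA n _ _ hb.symm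
    · intro h2
      by_contra h1
      rw [bigPerm_re_of_ne n _ _ b h1, bigPerm_re_of_eq n _ _ b h2] at hb
      exact RE_ne_PA n _ _ hb
  -- same rotation
  have hrot : rot n p 0 = rot n p' 0 := by
    by_cases h1 : lam n p a 0 = 1
    · have h2 := (htog 0).mp h1
      have hb := hperm ((Fin.natAdd (n + 1)) 0)
      rw [bigPerm_pa_of_eq n _ _ 0 h1, bigPerm_pa_of_eq n _ _ 0 h2] at hb
      exact RE_injective n hb
    · have h2 : lam n p' a' 0 ≠ 1 := fun h2 => h1 ((htog 0).mpr h2)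
      have hb := hperm ((Fin.castAdd (n + 1)) 0)
      rw [bigPerm_re_of_ne n _ _ 0 h1, bigPerm_re_of_ne n _ _ 0 h2] at hb
      exact RE_injective n hb
  have hpp : p = p' := by
    have h1 := rot_val n p hp 0
    have h2 := rot_val n p' hp' 0
    rw [Fin.val_zero, if_neg (by omega)] at h1
    rw [Fin.val_zero, if_neg (by omega)] at h2
    have := congrArg Fin.val hrot
    omega
  refine ⟨hpp, ?_⟩
  subst hpp
  have key : ∀ b : Fin (n + 1), (b : ℕ) < a ↔ (b : ℕ) < a' := fun b => by
    rw [← lam_eq_one_iff n p a ha b, ← lam_eq_one_iff n p a' ha' b]; exact htog b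
  by_contra hne
  rcases Nat.lt_or_gt_of_ne hne with hlt | hlt
  · have := (key ⟨a, by omega⟩).mpr hlt
    exact lt_irrefl _ this
  · have := (key ⟨a', by omega⟩).mp hlt
    exact lt_irrefl _ this

open Classical in
/-- **The two-boundary port has at least `T n (n+1) = C(n+3, 2) − 1` dominant terms.** -/
theorem T_le_card_dominant :
    T n (n + 1) ≤ (univ.filter fun q : Equiv.Perm (Fin ((n + 1) + (n + 1))) × (Fin ((n + 1) + (n + 1)) → Fin 3) =>
      ∃ t : ℤ, IsDominant (dd n) (bigV n) (bigE n) t q).card := by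
  set f : ℕ → Equiv.Perm (Fin ((n + 1) + (n + 1))) × (Fin ((n + 1) + (n + 1)) → Fin 3) :=
    fun k => bigTerm n (cterm n (grid n k).1 (grid n k).2) with hf
  have hinj : Set.InjOn f (range (T n (n + 1)) : Finset ℕ) := by
    intro k hk k' hk' hkk
    rw [Finset.coe_range, Set.mem_Iio] at hk hk'
    obtain ⟨h1, h2⟩ := grid_inv n k hk.le
    obtain ⟨h1', h2'⟩ := grid_inv n k' hk'.le
    obtain ⟨hp, ha⟩ := bigTerm_cterm_inj (grid_fst_le n k hk) h1 (grid_fst_le n k' hk') h1' hkk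
    rw [← h2, ← h2', hp, ha]
  have hsub : (range (T n (n + 1))).image f ⊆ univ.filter fun q => ∃ t : ℤ, IsDominant (dd n) (bigV n) (bigE n) t q := by
    intro q hq
    rw [mem_image] at hq
    obtain ⟨k, hk, rfl⟩ := hq
    rw [mem_range] at hk
    rw [mem_filter]
    refine ⟨mem_univ _, th n (grid n k).1 (grid n k).2, ?_⟩
    obtain ⟨h1, _⟩ := grid_inv n k hk.le
    exact isDominant_bigTerm (grid_fst_le n k hk) h1
  calc T n (n + 1) = (range (T n (n + 1))).card := (card_range _).symm
    _ = ((range (T n (n + 1))).image f).card := (card_image_of_injOn hinj).symm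
    _ ≤ _ := card_le_card hsub

open Classical in
/-- **A dense two-boundary design on `2m` nodes with at least `C(m+2,2) − 1` dominant terms** (`m = n + 1`). -/
theorem exists_twoBoundary_quadratic (n : ℕ) :
    ∃ (π ρ : Fin 2 → Equiv.Perm (Fin ((n + 1) + (n + 1)))) (lab : (Fin 2 → Bool) → Fin 3) (d : Fin 3 → ℕ)
      (v ε : Fin ((n + 1) + (n + 1)) → Fin ((n + 1) + (n + 1)) → Fin 3 → ℤ),
      IsBoundaryDesign π ρ lab ε ∧
      (n + 3).choose 2 - 1 ≤ (univ.filter fun q : Equiv.Perm (Fin ((n + 1) + (n + 1))) × (Fin ((n + 1) + (n + 1)) → Fin 3) =>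
        ∃ t : ℤ, IsDominant d v ε t q).card := by
  refine ⟨bd n, bd n, lab3, dd n, bigV n, bigE n, isBoundaryDesign_big n, ?_⟩
  have h1 := T_le_card_dominant (n := n)
  have h2 := T_last n
  omega

/-- **`¬ BoundaryVertexLaw 2 1`: dense boundary-type designs with TWO boundaries carry quadratically many dominant terms**
(against the located guess «BVL(2,1) linear»; `BoundaryVertexLaw 2 2`, if true, is sharp). -/
theorem not_boundaryVertexLaw_two_one : ¬ BoundaryVertexLaw 2 1 := by
  rintro ⟨C, hC⟩
  have h1 := hC ((4 * C + 1 + 1) + (4 * C + 1 + 1)) 3 (bd (4 * C + 1)) (bd (4 * C + 1)) lab3 (dd (4 * C + 1))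
    (bigV (4 * C + 1)) (bigE (4 * C + 1)) (isBoundaryDesign_big (4 * C + 1))
  have h2 := T_le_card_dominant (n := 4 * C + 1)
  have h3 := two_mul_T (4 * C + 1) (4 * C + 1 + 1) (by omega)
  have h4 : T (4 * C + 1) (4 * C + 1 + 1) ≤ C * ((4 * C + 1 + 1) + (4 * C + 1 + 1) + 1) := by
    have := h2.trans h1; simpa using this
  nlinarith

end TwoPort

end BoundarySector

end Summit.ValiantsHypothesis.ValiantsHypothesis.Theorems.KPlusLogSqLaw
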